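import Mathlib
import HarnessLib
import HarnessLib.Audit
import Summits.ABC.Statement
import Literature.NumberTheory.DiophantineGeometry.Conductor
import Literature.NumberTheory.DiophantineGeometry.MinimalDiscriminant
import Literature.NumberTheory.EllipticCurves.Szpiro
import Literature.NumberTheory.EllipticCurves.Isogeny

/-!
Route: RibetTakahashiSplit

DORMANT since 2026-09-03T06:56:04Z (reconciler: no traction for 5 d (last activity statement-checked at 2026-08-29T05:54:07Z); parked, not closed — `ledger route dormant route-ABC-RibetTakahashiSplit --off` to reactivate) — unstaffed, not closed; items shared with open routes are served there. `ledger route dormant <id> --off` reactivates.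

It suffices to show X = R2 ∧ R4 ∧ R3″ [card ABC/ABC/jl-preserves-integral-size; the ONE family route
for the congruence-number cards (definite-quaternion-xi-szpiro, frey-congruence-anatomy,
manin-integral-supnorm-v2, separator-ceiling-orbit-local, serre-potential-log-free-szpiro); rev
judge-repair 3043d596 (2026-08-17): the former ξ-half leaf R3′ = WeightedSzpiroBound, which is ⟺ ABC
(WeightedSzpiroBound.iff_abc) and made R2/R4 vacuous, is no longer a hypothesis of the deciding
theorem — it is DERIVED inside `closes` from R2, R4 and the new thin-class crux R3″, the honest
complement of the valuation-product half]. For E/ℚ semistable away from 2 (p² ∤ N_E for odd p — the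
Frey generality) write T(E) := ∏_{p ∥ N} ord_p(Δ_min(E)) (geometric component orders #Φ_p = the
δ_{1,N}/δ_{D,M} ratios of Ribet–Takahashi; not the arithmetic Tamagawa numbers).
 (R2, rank 2) ManyPrimeValuationProduct: T(E) ≤ C_ε N^ε whenever E has ≥ 4 odd multiplicative primes
= Pasten's folklore Conj. 1.14 in geometric form; by Ribet–Takahashi–Pasten (PastenShimura2024 Thm
6.1(b), §16) and ‖f‖² = N^{1+o(1)} (HoffsteinLockhart1994) it is EQUIVALENT to the typed Petersson
line 'Jacquet–Langlands preserves the size of the integral newform', ∫‖f^{int}_{D,M}‖² ≥ N^{1−ε} for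
the Néron-normalised JL transfer on ≤ 3 admissible Shimura curves X_0^D(M) (lever
MeanSquareLowerBound of Cruxes/ManyPrimeValuationProduct/Lines/jl_zero_cycle_height.lean, certified
crux-equivalent; live on the semistable-Frey re-cut R2SF = ManyPrimeValuationProductSemistableFrey,
line waldspurger-localisation; unconditional rung T ≤ N^{11/2+ε}, Pasten Thm 1.12, → 19/4 by
Khayutin–Nelson–Steiner sup-norms, STRATEGY-CENSUS F1).
 (R4, rank 4) FewPrimeValuationProduct: the same with ≤ 3 odd multiplicative primes (Pillai regime
p^x ± q^y = 2^k r^z; Frey hard core = crux FewPrimeHardCore, reductions landed).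
 (R3″, rank 3, REPAIRED 2026-08-17) ThinWeightedSzpiro: there is a class exponent θ > 0 such that
for every ε > 0 AND EVERY K there is C with max(|Δ(W₀)|,|c₄(W₀)|³) ≤ C (N·T)^{6+ε} for every global
minimal W₀ semistable away from 2 that is θ-THIN, T(W₀) ≤ K·N^θ — generalized Szpiro
(BombieriGubler2006 12.5.11) on a thin class whose exponent is FROZEN (bound once, outside ∀ε).
Kernel-checked position (planner Sketch.lean): ABC → WeightedSzpiroBound → R3″ (restriction); R2 ∧
R4 ∧ R3″ → R3′ (R2(θ), R4(θ) certify θ-thinness of every curve, 20 lines of logic = the body of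
closes). The first wording (class exponent = the Szpiro ε) was refuted-MISSTATED (refuter
Collapse.lean: modulo the printed pastenShimura2024_cor_16_2 it is ⟺ ABC — at ε = 6 every curve is
thin, giving polynomial Szpiro, T ≤ N^{o(1)}, R2, R3′, ABC); with θ frozen that bootstrap needs
unconditional thinness at level θ, in print only for θ > 8/3 (Frey / many-prime: Pasten Thm 1.10 /
16.5) resp. θ > 11/2 (Cor 16.2 / Thm 1.12), and R3″ → ABC alone would need it at EVERY θ > 0, i.e.
R2 ∧ R4 themselves.
 X → ABC: closes (h₂ : ManyPrimeValuationProduct) (h₄ : FewPrimeValuationProduct) (hT :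
ThinWeightedSzpiro) (hA : Assembly) : ABC := hA h₂ h₄ ⟨R3′ derived from h₂ h₄ hT: θ from hT, K :=
max K₂(θ) K₄(θ), case split on the number of odd multiplicative primes⟩, Assembly = R2 → R4 → R3′ →
ABC PROVED (WeightedSzpiroBound.assembly_of_crux: exists_minimal_frey_model, c⁶ ≤ 8|c₄|³ ≤ M
rad^{6+6ε}).
 Division of labour (why the split is real): deg φ_E = ξ(N⁺,N⁻) × ∏_{q|N⁻} v_q(Δ) × γ
(RibetTakahashi1997, PollackWeston2011 Thm 6.8, Pasten Thm 6.1). R2/R4 bound the LOCAL factors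
(component groups) with Pasten's analytic Shimura-curve engine; R3″ bounds the GLOBAL factor on the
class where all local factors are ≤ K·N^θ (given, not to be proved; T also weights the right-hand
side), i.e. where deg φ_E is, up to the given factor T, the pure new-quotient congruence number =
the length of one minimally ramified adjoint Selmer module (Diamond's numerical criterion) — the R =
T / Bloch–Kato toolbox, no Tamagawa fudge left.
Lean: X := ManyPrimeValuationProduct ∧ FewPrimeValuationProduct ∧ ThinWeightedSzpiro over
WeierstrassCurve ℚ / WeierstrassCurve ℤ, W.conductorNorm ℤ, W.minimalDiscriminantNorm ℤ,
W.IsMinimalAt, Nat.primeFactors / Nat.factorization (imports Conductor + MinimalDiscriminant only;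
planner Sketch.lean rc 0, closes native-certified).
Milestones unchanged (glues proved): R2 → SubexpABCManyPrimes; R2 ∧ R4 → AbcValuationProduct
(Pasten's d(abc)-theorem with 8/3 ↦ ε) → sub-exponential abc ∀ε, log c ≤ κ_ε rad^ε.

Rationale: WHY THIS LINE. The only method that has ever produced sub-exponential or global 'product of
valuations' information on abc is Pasten's Shimura-curve method (PastenShimura2024 =
arXiv:1705.09251: Thm 1.10 ∏ v_p(abc) ≤ K_ε rad^{8/3+ε}, Thm 1.12 ∏_{p|N} v_p(Δ_E) ≤ K_ε
N^{11/2+ε}); it bounds the RATIOS δ_{1,N}/δ_{D,M} = ∏_{p|D} v_p(Δ_E)·γ (RibetTakahashi1997; Pasten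
Thm 6.1) through a Petersson LOWER bound for integral quaternionic forms (Thm 1.6). The card's
point: for the EIGENFORM f_{D,M} the truth is ‖f_{D,M}‖² = N^{1+o(1)}/T(E), so 'JL preserves
integral size' ⟺ T(E) ≤ N^{o(1)} (Conj. 1.14) — the typed Petersson line of R2 (levers
MeanSquareLowerBound / ZeroCycleHeight over ShimuraCurveData, certified crux-equivalent in the crux
Lines; live on R2SF, line waldspurger-localisation; θ-rung 11/2 → 19/4 by Khayutin–Nelson–Steiner
arXiv:2207.12351, STRATEGY-CENSUS F1). Imported areas: automorphic forms/JL (Pasten, RT, BKM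
arXiv:2108.09729), Arakelov geometry and CM heights (KRY, Yuan–Zhang inside Pasten §§10–15),
analytic number theory (HoffsteinLockhart1994), definite quaternion algebras (PollackWeston2011),
and — for R3″ — R = T / adjoint Selmer control (Diamond1997). REV judge-repair 3043d596 (2026-08-17;
judge: 'Re-wire closes so r2/r4 are cruxes with typed Petersson line, and drop WeightedSzpiro as
leaf'). Diagnosis: in every ∀ε Szpiro- or degree-shaped chain the component product is ABSORBED (T ≤
K_η|Δ_min|^η, divisor bound, landed prod_factorization_le_rpow /
valuationProduct_le_rpow_minimalDiscriminantNorm), which is why R3′ = WeightedSzpiroBound alone gave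
ABC (iff_abc, p77854) and R2/R4 entered Assembly/Assembly2/Assembly3 vacuously. The only honest way
for the valuation-product half to bear load toward ABC is a REGIME split: R3″ ThinWeightedSzpiro =
weighted Szpiro on a thin class {T ≤ K N^θ} with a FROZEN exponent (∃θ>0 ∀ε ∀K ∃C; route-repair
2026-08-17: the first wording {T ≤ K N^ε}, same ε as the Szpiro exponent, was refuted-misstated —
modulo the printed Pasten Cor 16.2 it bootstrapped to ABC at ε = 6, refuter Collapse.lean; the
frozen θ is the refuter's repair C′ with the numeral θ₀ ≤ 8/3 weakened to ∃θ > 0), R2 ∧ R4 = 'every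
curve semistable away from 2 is θ-thin for every θ > 0'. closes derives R3′ from the three (inline,
20 lines: θ from R3″, R2(θ) ∧ R4(θ) for membership) and feeds the PROVED Assembly; r2
(stmt-ABC-1561) and r4 (stmt-ABC-1563) are crux-kind binders again; R3′ (stmt-ABC-3272) is a derived
support node kept verbatim for its ~20 Theorems references (Abc, OfDefiniteXi, Bootstrap,
SlackTransfer, LeverCalibration…). WHY R3″ IS MORE ATTACKABLE THAN R3′/ABC (D-0031 axis 1): on the
θ-thin class every level-lowering factor of deg φ_E = ξ(N⁺,N⁻)·∏_{q|N⁻} v_q(Δ)·γ is ≤ T ≤ K N^θ and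
is GIVEN, and T also weights the target (N·T)^{6+ε}; so, up to the bookkeeping of the
DegreeConjectureAbc chain (Zagier + GHL + Silverman; PeterssonLowerBound = DefiniteXi item
stmt-ABC-10870 as the typed Petersson input), R3″ reads [minimal modular degree ≤ N^{2+ε}·T^{1+ε} on
θ-thin Frey curves] ⟸ [pure N-new congruence number η^{new}(f_E) = ξ ≤ N^{2+ε}·T^{ε}] = a bound on
ONE minimally ramified adjoint Selmer length with no Tamagawa terms: named tools are Diamond's
numerical criterion / Taylor–Wiles patching (η^{min} as a congruence-module length), Hida's adjoint
L-value formula, and DefiniteXi's Brandt-module census (reads ξ directly). The non-thin class (few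
primes with large exponents: Pillai/Hall corner, transcendence regime) is delegated to R2/R4, whose
engine is analytic — two different toolboxes for two factors of the same integer deg φ_E. Relation
to route DefiniteXi: it cuts the same integer as (6-part) × (prime-to-6 part incl. all v_q) on the
definite side; this route cuts it as (local component factors) × (global factor on the thin class);
neither cone contains the other.
RANKED CRUXES. r2 ManyPrimeValuationProduct (stmt-ABC-1561, binder) — T(E) ≤ C_ε N^ε for E
semistable away from 2 with ≥ 4 odd multiplicative primes; why it might fail: mechanism (KS/integral
defect ≍ log p per prime even on average); = R2SF (stmt-ABC-15174, the live semistable-Frey re-cut,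
line waldspurger-localisation) + semistable non-Frey class (Fermat input Mestre–Oesterlé, known XL)
+ additive-at-2 residual (Fermat input open) — see TENURE TODO for the cut that needs only R2SF. r3″
ThinWeightedSzpiro (binder; REPAIRED 2026-08-17, frozen class exponent ∃θ > 0) — thin-class weighted
Szpiro; why it might fail: ABC → r3″ so only ¬ABC refutes it — on T = 1 curves (squarefree odd
Δ_min, inside every θ-class) it is already Hall-type, |c₄| ≪ rad(Δ)^{2+ε}; false iff for every θ > 0
some θ-thin (e.g. bounded-T) family has limsup log max(|Δ|,|c₄|³)/log(N·T) > 6; ε = 0 false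
(Masser); design risk: a printed 'T ≪ N^θ for every θ > 0 on Frey curves' (= r2 ∧ r4) re-collapses
it to ABC; sources BombieriGubler2006, Masser1990, Silverman1986, PollackWeston2011, Diamond1997,
arXiv:2108.09729, PastenShimura2024, Literature.Barriers.ABC.HallExponentSharp. r4
FewPrimeValuationProduct (stmt-ABC-1563, binder) — ≤ 3 odd multiplicative primes, Pillai regime;
Frey hard core = crux FewPrimeHardCore (stmt-ABC-15197; hard core ⟹ r4 on non-face Frey triples
LANDED p98652, power-of-two face KNOWN p84330). Declared cruxes outside the closes cone, kept for
the crux programme: R2SF 15174 (⟸ r2; lead lineage), FewPrimeHardCore 15197, MazurKenkuRadius 15193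
and IsogenyDegreeBound 15192 (radius inputs of the JL packages, one Mazur–Kenku lineage). Support:
WeightedSzpiroBound 3272 (DERIVED, ⟺ ABC), ManyPrimeValuationProductFrey 15149, and the PROVED glues
Assembly (r2 → r4 → R3′ → ABC), Assembly2 (ω-lift), ManyPrimeFreyOfManyPrime,
SubexpOfValuationProduct, SubexpManyPrimesOfValuationProduct, ValuationProductOfCurves,
DiscrepancyPotentialBound.
KILL CRITERIA. (i) r2 or r4 refuted is impossible short of ¬ABC (ABC → r2 ∧ r4 landed,
manyPrime_and_fewPrime_of_abc); a MECHANISM kill (a proof that the KS defect of p-new eigenforms at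
CM points is ≥ c log p on average; a published JL family with ‖f_{D,M}‖² ≤ N^{1−c}‖f‖²) makes r2
engine-less → dormant. (ii) r3″ refuted = for every θ > 0 a θ-THIN family (T ≤ K N^θ; e.g. bounded
T) of curves semistable away from 2 with max(|Δ|,|c₄|³) ≥ (N·T)^{6+δ} — e.g. a Hall/Danilov-type x³
− y² = k family with limsup Szpiro ratio > 6; this is ¬ABC — closes the path to ABC (close
refuted:ThinWeightedSzpiro; the route shrinks to the milestone ladder SubexpABCManyPrimes /
AbcValuationProduct, tenure closes superseded/exhausted unless a milestone is in reach). (iii) a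
LANDED theorem ThinWeightedSzpiro → ABC (or → WeightedSzpiroBound without r2/r4; for the repaired
statement this needs unconditional thinness of Frey curves at EVERY level θ > 0 — the same-ε wording
died exactly this way at the single level ε = 6, refuter Collapse.lean 2026-08-17) shows the split
cosmetic: then the honest reading is that the valuation-product half is a milestone programme
(sub-exponential abc), not a step to ABC, and the route is re-planned or merged into DefiniteXi's
ξ-programme.
NOT DECOMPOSED YET. r3″ ← [ThinDegreeReduction: on thin Frey curves deg_min φ_E ≤
N^ε·ξ(N⁺_min,N⁻_max)·163^{ω} — Pasten Thm 6.1 + MazurKenkuRadius, known] + [ThinXiBound: ξ at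
maximal quarantine ≤ N^{2+ε} on thin curves — the research stub (Brandt eigenvector length /
minimally ramified adjoint Selmer)] + PeterssonLowerBound (GHL, DefiniteXi stmt-ABC-10870, to be
re-attached here when the split is filed) + zagier_degree_formula_holds /
silverman1986_discriminant_c4_covolume_holds (PROVED) — typed over ModularParametrizationData /
brandtXi in Theorems files, never in this file (cone = Conductor + MinimalDiscriminant). TENURE TODO
(the better cut, P2): file and land the support glue OmegaLiftThinAssembly :
ManyPrimeValuationProductSemistableFrey → ThinWeightedSzpiro → ABC — PROVABLE NOW:
DiophantineGeometry.abcLe_of_abcLe_sixteen_dvd (reduce to 16 ∣ abc), OmegaLift.manyPrimes_step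
re-run inside the class 16 ∣ abc (the cubic lift a³ + b(3a²+3ab+b²) = c³ never lowers v₂), then per
triple: semistable Frey model (exists_arrangement / exists_minimal_frey_model), θ from r3″, thinness
from R2SF at level θ (constant K), r3″ at (δ, K) with δ = min(ε,1)/2, T absorbed by R2SF again at
level δ/20: c⁶ ≤ 8|c₄|³ ≤ 8C(K′N^{δ/20}·N)^{6+δ}, N ∣ 2^10 rad — verbatim the bookkeeping of
WeightedSzpiroBound.abcLe_of; then re-point closes to (R2SF, r3″, OmegaLiftThinAssembly) and
re-badge 1561/1563 support: the few-prime regime is NOT needed for ABC (ω-lift,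
OmegaLift.abc_of_manyOddPrimes landed), only for the milestone AbcValuationProduct. STATUS
2026-08-17 (route-repair rrefute 9a5700cc): the per-triple half of this glue WAS filed as
ThinFreyTransfer (stmt-ABC-17852: R2SF → r3″ → abc for 16 ∣ abc, ≥ 4 odd primes) and proved at
05:13Z (thinFreyTransfer_proof, Theorems/RibetTakahashiSplitThinFreyTransfer.lean) — but against the
MISSTATED same-ε r3″ (`hT δ hδ (max K 1)`); the repair of r3″ invalidates that proof term and the
item is DROPPED in the same edit (cap 15; its decl would otherwise be a proved item with a
non-compiling proof). Re-file it verbatim against the repaired r3″ when a slot is free: the proof is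
the same file with two levels (θ from r3″ and R2SF(θ) for membership; R2SF(δ/20) to absorb T), its
lemmas ThinFreyTransfer.exists_semistable_minimal_frey_model / exponent_le carry over unchanged.
r2's typed Petersson line stays at LINE level (registered levers; θ-ladder) — no route item, by the
2026-08-15 review of the ∃S_int rendering.
CHEAPEST FALSIFIER. (a) r3″, one hour, a lookup plus one kit-pari job: take the Szpiro-ratio record
curves (Nitaj's tables; LMFDB sorted by szpiro_ratio, records ≈ 8.8–9) and Cremona curves semistable
away from 2 with N ≤ 5·10^5; tabulate σ(E) = log max(|Δ_min|,|c₄|³) / log(N·T(E)) against the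
thinness τ(E) = log T(E)/log N. Prediction of the split: the large-σ curves are THIN (few primes,
exponents ≤ 30, τ small) — so r3″ inherits exactly the Szpiro record families and its exponent 6+ε
is tested by whether σ on the thin slice τ ≤ 0.1 keeps growing with N (it must flatten toward ≤
6·(1+ε)). An increasing envelope sends r3″ (and the thesis that the ξ-half is easier on the thin
class) back to the planner. (b) bibliographic: a published implication 'Szpiro for curves with T(E)
≤ N^{o(1)} ⟹ Szpiro' would make the split cosmetic — searched this session (lit search s2 'abc
conjecture powerful numbers Szpiro ratio Hall conjecture': Broughan 2002 relaxations only; local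
hybrid 'Szpiro ratio record … exponent product': Baker2004 experiments, BombieriGubler2006 pp.
418–437, Masser's families in Literature.Barriers.ABC.SzpiroEpsilonCannotBeDroppedMasserProofs —
none gives it; zbMATH 0 hits; OpenAlex quota-exhausted). (c) typing: closes re-certified on the
repaired statement; bc probes (planner bc/ThinR_probe_*.lean): ThinWSB → ABC fails
(exact?/simpa/aesop, also with pastenShimura2024_cor_16_2 / thm_16_5_manyPrimes / thm_1_12 in
context), `example : ThinWSB` fails (not a known theorem), ¬ThinWSB by automation fails, ABC →
ThinWSB elaborates. (d) the cheapest kill of the DESIGN (not of the truth): exhibit a printed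
unconditional 'T ≤ K_θ N^θ for every θ > 0' on some class containing the minimal Frey models of all
but finitely many abc triples — then r3″ → ABC as in Collapse.lean; none found — the printed
exponents remain 8/3 + ε on abc triples (Pasten arXiv:1705.09251 Thm 1.10 = JNT Thm 16.8, tree
pasten2024_thm_2_5) and 11/2 + ε in general (Thm 1.12 / Cor 16.2–16.3, quoted as the state of the
art in Cuevas–Pasten arXiv:2504.15971 Thm 1.6, read this session p.4); arXiv listing 'Pasten abc'
re-checked this session (2406.05083, 2312.03566, 2504.15971: no sharper valuation-product exponent).

Novelty: Nearest prior art FOUND and read: PastenShimura2024 = arXiv:1705.09251 (held; read this session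
pp.4–9: Thms 1.3–1.6, 1.10–1.15, Conj. 1.14 'fudge factors are small, folklore … not a mild
conjecture: implies log Δ ≪ N^ε'; p.20 Thm 6.1 (refined Ribet–Takahashi, hypotheses (b.1)/(b.2));
p.49 §16: log ∏_{p|D} v_p(Δ) = 2 log c_f + 2 log‖f‖ − 2 log‖f_{D,M}‖ + O(…), f_{D,M} = integral
pull-back of the Néron differential) — proves the GENERAL-integral-form bound Thm 1.6 and hence
exponents 11/2 (Thm 1.12) and 8/3 (Thm 1.10); RibetTakahashi1997 + Takahashi 2001 +
Böckle–Khare–Manning arXiv:2108.09729 + PollackWeston2011 + Moakher arXiv:2408.15410 (zbMATH hit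
this session: 'quantitative level lowering', Hilbert case) — all compute exact p-PARTS of degree
ratios / congruence numbers, never an archimedean SIZE bound; MurtyCongruencePrimes1999 / Frey
(degree conjecture ⟺ height conjecture ⟹ ABC); HoffsteinLockhart1994 (‖f‖² ≫ N^{1−ε});
arXiv:2312.03566 (uses 8/3 as a black box; card). Searches run: card's (lit read 1705.09251 full
grep; 2312.03566; zbMATH 'abc conjecture modular degree quaternion'; lit frontier ABC --since 2020)
+ this session: zbMATH 'Ribet Takahashi parametrization Shimura curves' (3 hits: Moakher 2024,
Pasten 2024, Takahashi 2009), zbMATH 'Petersson norm quaternionic modular form lower bound integral'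
(0), lit search --hybrid local 'Ribet Takahashi Shimura curve modular degree component' (textbooks
only), lit vsearch 'product of Tamagawa numbers bounded by N^ε … Peter  [refs: 1705.09251, 2108.09729, 2408.15410, 2312.03566, PastenShimura2024, RibetTakahashi1997, PollackWeston2011, MurtyCongruencePrimes1999, HoffsteinLockhart1994, Pasten2024]

Barriers (technique_class: shimura-eigenform-petersson-lb|RT-degree-ratio|deg-split): technique_class: shimura-eigenform-petersson-lb|RT-degree-ratio|deg-split
- Literature.Barriers.ABC.BakerMethodBounds: NOT in the technique class (no linear forms in
logarithms anywhere; inputs are Jacquet–Langlands, Arakelov heights of CM points, Zagier's degree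
formula, GHL). The barrier is the BENCHMARK: its state of the art is BakerShapeBound (1/3) 3
(Stewart–Yu); the route's typed milestones SubexpABCManyPrimes (log c ≤ κ_ε rad^ε when ω(abc) ≥ 5)
and SubexpABC (∀ε, BakerShapeBound ε 0) lie strictly below every (θ>0, m) the class has produced;
the barrier file itself records (evasions_known (c), Pasten2024) that the modular/Shimura method is
the only known source of sub-exponential bounds, in the complementary small-min-prime regime.
- Literature.Barriers.ABC.EpsilonCannotBeDropped (and the sibling files SzpiroEpsilonCannotBeDropped
/ SzpiroEpsilonCannotBeDroppedSemistable of the same catalogue family): RESPECTED — every statement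
carries N^ε / rad^ε (R2, R4: T(E) ≤ C_ε N^ε; R3: N^{2+ε}; F: N^{1−ε}; G: covol^{−6−ε}). Checked
against Masser's Szpiro-sharp families (file SzpiroEpsilonCannotBeDroppedMasserProofs): there ω(N) ≍
√(log N)/log log N primes carry exponents ≍ √(log N)/log p, so T(E) = exp(O(√log N)) = N^{o(1)} —
consistent with R2; an ε-free R2 (T(E) ≤ C) is FALSE by the same families and is not claimed.
- Literature.Barriers.ABC.BakerShapeConstantFloor / Literature.Barriers.ABC.ExplicitABCQualityFloor:
not engaged — no explicit constants or explicit exponents are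

History (route lifecycle, newest last):
- 2026-08-17T04:33:59Z · rev 36: dropped stmt-ABC-1755 — judge-repair 3043d596: drop the informal item stmt-ABC-1755 (EigenformLowerBound, no Lean statement since 2026-08-15; its typed form is the registered lever Mea (planner-rrepair-ABC-RibetTakahashiSplit-judge-3043d596-0)
- 2026-08-17T04:37:43Z · rev 37: dropped stmt-ABC-15192 — judge-repair 3043d596: drop IsogenyDegreeBound (stmt-ABC-15192; KNOWN in print — Mazur1978 Thm 1 + Kenku1982 give radius 163, ε-free; the corollary of the kept (planner-rrepair-ABC-RibetTakahashiSplit-judge-3043d596-0)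
- 2026-08-17T05:17:30Z · rev 40: restated ThinWeightedSzpiro (stmt-ABC-17736) — route-repair (refuted-misstated by refuter-rattack-stmt-ABC-17736-0, Collapse.lean: pastenShimura2024_cor_16_2 → (ThinWeightedSzpiro_old ↔ ABC), same-ε bootstra (planner-rrefute-ABC-RibetTakahashiSplit-stmt-A-9a5700cc-0)
- 2026-08-17T05:17:30Z · rev 40: dropped ThinFreyTransfer — route-repair (refuted-misstated by refuter-rattack-stmt-ABC-17736-0, Collapse.lean: pastenShimura2024_cor_16_2 → (ThinWeightedSzpiro_old ↔ ABC), same-ε bootstra (planner-rrefute-ABC-RibetTakahashiSplit-stmt-A-9a5700cc-0)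
- 2026-08-17T06:27:44Z · LINT AUTOFIX route.multi-assembly: kept Assembly, dropped Assembly2 (gate:hygiene)
- 2026-08-24T14:28:32Z · DORMANT — reconciler: no traction for 6.8 d (last activity item-evidence-added at 2026-08-17T17:59:22Z); parked, not closed — `ledger route dormant route-ABC-RibetTakahas (operator:999:944788)
- 2026-08-29T05:48:52Z · REACTIVATED — reconciler: reactivated — activity statement-checked at 2026-08-29T04:19:41Z after parking at 2026-08-24T14:28:32Z (operator:999:1310214)
- 2026-09-03T06:56:04Z · DORMANT — reconciler: no traction for 5 d (last activity statement-checked at 2026-08-29T05:54:07Z); parked, not closed — `ledger route dormant route-ABC-RibetTakahashiSp (operator:999:1150173)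

sub-problem: ABC · status: dormant · opened planner-plancard-ABC-ABC-jl-preserves-integra-d4310df1-0 2026-08-15T10:57:23Z · rev 46 · ledger route-ABC-RibetTakahashiSplit
GENERATED by the gate from the ledger (D-0016/17). Provers cite these decls: `theorem foo : Summit.ABC.ABC.Theses.RibetTakahashiSplit.<Decl> := …` in Summits/ABC/ABC/Theorems/<Name>.lean.
-/

namespace Summit.ABC.ABC.Theses.RibetTakahashiSplit

open scoped BigOperators Topology Manifold Classical MeasureTheory ProbabilityTheory Matrix InnerProductSpace ComplexConjugate ContinuousMap
open Filter Set Function TopologicalSpace MeasureTheory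

attribute [summit_statement] _root_.ABC

open Literature.Abc

/-- item stmt-ABC-1561 · crux (kind.auto-crux: conjecture-grade) · rank 2 · open · by planner
why it might fail: Truth: only ¬ABC refutes it (ABC ⇒ Szpiro ⇒ r2, manyPrimeValuationProduct_of_abc). Load-bearing again: with r3″ thin-class the WSB bootstrap no longer derives it. Mechanism: KS/integral defect of f_{D,M} ≍ log p per prime even on average ⇒ ‖f_{D,M}‖² ≈ N^{1−c}; both levers certified crux-equivalent.
sources: PastenShimura2024, arXiv:1705.09251, RibetTakahashi1997, HoffsteinLockhart1994, Cesnavicius2018, arXiv:2207.12351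
[crux] r2 (card ABC/ABC/jl-preserves-integral-size): MANY-PRIME valuation product = Pasten's
folklore Conj. 1.14 in geometric form. For E/Q semistable away from 2 (p^2 does not divide N for odd
p) with >= 4 odd multiplicative primes, T(E) := prod_{p || N} ord_p(Delta_min(E)) <= C_eps N^eps
('Tam' = geometric component orders ord_p(Delta) = #Phi_p, not the arithmetic Tamagawa numbers).
LINE OF ATTACK (informal item EigenformLowerBound): 'Jacquet-Langlands preserves the size of
integral newforms' — ||f_{D,M}||^2 >= N^{1-o(1)} for the integrally normalised JL transfer of f_E to
X_0^D(M) — applied to <= 3 admissible factorisations N = DM covering all multiplicative primes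
(possible iff >= 4 odd ones, Pasten Thm 6.1(b)), plus the refined Ribet-Takahashi identity log
prod_{p|D} v_p(Delta) = 2 log c_f + 2 log||f|| - 2 log||f_{D,M}|| + O(log D/loglog D)
(PastenShimura2024 Thm 6.1(b) and §16 p.49), ||f||^2 = N^{1+o(1)} (HoffsteinLockhart1994) and c_f
bounded (Cesnavicius2018; Pasten Thm 1.3 with S={2}). Unconditionally T(E) <= K_eps N^{11/2+eps}
(Pasten Thm 1.12, from the general-integral-form bound Thm 1.6, which congruence quotients cap near
N^{-2}: any improvement must be eigenform-speci -/
@[route_item "route-ABC-RibetTakahashiSplit"]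
def ManyPrimeValuationProduct : Prop :=
  ∀ ε : ℝ, 0 < ε → ∃ C : ℝ, ∀ (W : WeierstrassCurve ℚ) [W.IsElliptic], (∀ p : ℕ, p.Prime → p ≠ 2 → ¬ p ^ 2 ∣ W.conductorNorm ℤ) → 4 ≤ ((W.conductorNorm ℤ).primeFactors.filter (fun p => p ≠ 2 ∧ ¬ p ^ 2 ∣ W.conductorNorm ℤ)).card → ((∏ p ∈ (W.conductorNorm ℤ).primeFactors with ¬ p ^ 2 ∣ W.conductorNorm ℤ, (W.minimalDiscriminantNorm ℤ).factorization p : ℕ) : ℝ) ≤ C * (W.conductorNorm ℤ : ℝ) ^ ε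

-- earlier ThinWeightedSzpiro (stmt-ABC-17736, replaced 2026-08-17T05:17:30Z -> stmt-ABC-17927): retired by None — ∀ ε : ℝ, 0 < ε → ∀ K : ℝ, ∃ C : ℝ, ∀ W₀ : WeierstrassCurve ℤ, (W₀.baseChange ℚ).IsElliptic → (∀ v : IsDedekindDomain.HeightOneSpectrum ℤ, (W₀.baseChange ℚ).IsMinimalAt v) → (∀ p : ℕ, p.Prime → p ≠ 2 → ¬ p ^ 2 ∣ (W₀.baseChange ℚ).conductorNorm ℤ) → ((∏ p ∈ ((W₀.baseChange ℚ).conductorNorm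
/-- item stmt-ABC-17927 · crux · rank 3 · open · by planner
why it might fail: ABC → r3″: only ¬ABC refutes it; on T=1 curves (squarefree odd Δ_min; in every θ-class) it is already Hall-type: |c₄| ≪ rad(Δ)^{2+ε} (c₄³−c₆² = 1728Δ); false iff a bounded-T family has limsup log max(|Δ|,|c₄|³)/log(N·T) > 6; ε=0 false (Masser). Design: a printed T ≪ N^θ ∀θ>0 (Frey) re-collapses it
sources: BombieriGubler2006, Masser1990, Silverman1986, RibetTakahashi1997, PollackWeston2011, Diamond1997
[crux] r3″ THIN-CLASS WEIGHTED SZPIRO WITH A FROZEN CLASS EXPONENT (route-repair 2026-08-17 of the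
judge-repair 3043d596 statement, which was refuted-MISSTATED by refuter-rattack-stmt-ABC-17736-0,
evidence Collapse.lean, kernel-checked: with the class exponent EQUAL to the Szpiro ε,
`pastenShimura2024_cor_16_2 → (r3″_old ↔ ABC)` — at ε = 6 Pasten Cor 16.2 (printed, unconditional: T
< K·N^{11/2+1/2} for curves semistable away from 2 with ≥ 2 multiplicative primes) makes every such
curve thin, r3″_old(6, K) is polynomial Szpiro there, hence T ≤ N^{o(1)} by the divisor bound, hence
r2, r3′ and ABC). STATEMENT: there is a class exponent θ > 0 such that for every ε > 0 and every K
there is C with max(|Δ(W₀)|, |c₄(W₀)|³) ≤ C·(N·T(W₀))^{6+ε} for every global minimal ℤ-model W₀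
(elliptic, minimal at every v) semistable away from 2 (p² ∤ N for odd p) that is θ-THIN: T(W₀) :=
∏_{p ∣ N, p² ∤ N} ord_p(Δ_min) ≤ K·N^θ. = generalized Szpiro (BombieriGubler2006 Conj. 12.5.11) on a
thin class whose exponent θ is bound ONCE, outside ∀ε — the refuter's repaired statement C′
("decouple and freeze the class exponent") with the fixed numeral θ₀ ≤ 8/3 replaced by ∃ θ > 0, the
weakest form the deciding th -/
@[route_item "route-ABC-RibetTakahashiSplit"]
def ThinWeightedSzpiro : Prop :=
  ∃ θ : ℝ, 0 < θ ∧ ∀ ε : ℝ, 0 < ε → ∀ K : ℝ, ∃ C : ℝ, ∀ W₀ : WeierstrassCurve ℤ, (W₀.baseChange ℚ).IsElliptic → (∀ v : IsDedekindDomain.HeightOneSpectrum ℤ, (W₀.baseChange ℚ).IsMinimalAt v) → (∀ p : ℕ, p.Prime → p ≠ 2 → ¬ p ^ 2 ∣ (W₀.baseChange ℚ).conductorNorm ℤ) → ((∏ p ∈ ((W₀.baseChange ℚ).conductorNorm ℤ).primeFactors with ¬ p ^ 2 ∣ (W₀.baseChange ℚ).conductorNorm ℤ, ((W₀.baseChange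 ℚ).minimalDiscriminantNorm ℤ).factorization p : ℕ) : ℝ) ≤ K * (((W₀.baseChange ℚ).conductorNorm ℤ : ℕ) : ℝ) ^ θ → ((max |W₀.Δ| (|W₀.c₄| ^ 3) : ℤ) : ℝ) ≤ C * ((((W₀.baseChange ℚ).conductorNorm ℤ : ℕ) : ℝ) * ((∏ p ∈ ((W₀.baseChange ℚ).conductorNorm ℤ).primeFactors with ¬ p ^ 2 ∣ (W₀.baseChange ℚ).conductorNorm ℤ, ((W₀.baseChange ℚ).minimalDiscriminantNorm ℤ).factorization p : ℕ) : ℝ)) ^ (6 + ε)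

/-- item stmt-ABC-1563 · crux · rank 4 · open · by planner
why it might fail: abc-strength in the Pillai regime (p^x ± q^y = 2^k r^z): p-adic two-log forms give only ord ≪ p·polylog (BakerMethodBounds (i)); no admissible N = DM for Pasten Thm 6.1(b) with ≤ 2 odd mult. primes; residual depth = Linnik wall. M–O, LFL, Pasten L.6.10, Shafarevich are cited inputs, never items.
sources: PastenShimura2024, StewartYu2001, Pasten2024, MestreOesterle1989, VonkanelMatschke2023, Literature.Barriers.ABC.BakerMethodBounds
[crux] r4 (FEW-PRIME regime, complementary to r2): T(E) <= C_eps N^eps for E/Q semistable away from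
2 with <= 3 odd multiplicative primes. For Frey curves this is the regime omega(abc) <= 4: p^x +-
q^y = 2^k r^z, 1 + 2^k q^n = p^m (Pillai/Catalan type). The JL mechanism of r2 does NOT apply: no
admissible N = DM satisfies Pasten Thm 6.1(b) (semistable needs M not prime, Frey needs two odd
primes in M) except semistable omega(N) in {2,4}; known unconditionally only for semistable omega(N)
= 1 (prime conductor, Mestre-Oesterle: ord_p(Delta) bounded). Candidate mechanisms: extend Pasten's
cokernel bound (Thm 1.4) to M prime / M = 2^k * prime; auxiliary-level JL transfers (f as an oldform
on X_0^D(M l l')); or the few-prime cards three-prime-powers-padic-exponent,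
two-adic-hall-corner-szpiro-2p, odd-conductor-pq-torsion-faces-v2. Load-bearing for Assembly and for
AbcValuationProduct/SubexpABC, NOT for SubexpABCManyPrimes. WHY IT MIGHT FAIL (long form):
abc-strength information in the Pillai regime, where both transcendence (p-adic factor p,
Literature.Barriers.ABC.BakerMethodBounds) and the Shimura-curve method are silent; nothing beyond
Stewart-Yu's rad^{1/3}(log rad)^3 is known unifo -/
@[route_item "route-ABC-RibetTakahashiSplit"]
def FewPrimeValuationProduct : Prop :=
  ∀ ε : ℝ, 0 < ε → ∃ C : ℝ, ∀ (W : WeierstrassCurve ℚ) [W.IsElliptic], (∀ p : ℕ, p.Prime → p ≠ 2 → ¬ p ^ 2 ∣ W.conductorNorm ℤ) → ((W.conductorNorm ℤ).primeFactors.filter (fun p => p ≠ 2 ∧ ¬ p ^ 2 ∣ W.conductorNorm ℤ)).card ≤ 3 → ((∏ p ∈ (W.conductorNorm ℤ).primeFactors with ¬ p ^ 2 ∣ W.conductorNorm ℤ, (W.minimalDiscriminantNorm ℤ).factorization p : ℕ) : ℝ) ≤ C * (W.conductorNorm ℤ : ℝ) ^ ε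

/-- item stmt-ABC-15149 · support · rank 2 · open · by planner
why it might fail: Truth level: only ¬ABC/¬Szpiro refutes it (Conj. 1.14 on Frey curves follows from Szpiro: de Weger–Hindry). Mechanism: the KS/integral-structure defect of the JL transfer f_{D,M} may cost ≍ log p per prime p | DM even on Galois average, leaving ‖f_{D,M}‖² ≈ N^{1−c}, T(E) up to N^c.
sources: PastenShimura2024, 1705.09251, RibetTakahashi1997, HoffsteinLockhart1994, BombieriGubler2006, Ribet1997
[crux] r2F (rev 6 = route-choice re-cut of the whole-class r2 ManyPrimeValuationProduct,
stmt-ABC-1561, to the Frey–Hellegouarch class; card ABC/ABC/jl-preserves-integral-size). For E/ℚ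
ℚ-isomorphic to a twisted Frey curve freyCurve (d a) (d b) (a, b coprime, ab(a+b) ≠ 0, d ∣ 2 —
within the curves semistable away from 2 exactly those with full rational 2-torsion) having ≥ 4 odd
multiplicative primes, T(E) := ∏_{p ∥ N} ord_p(Δ_min(E)) ≤ C_ε N^ε (geometric component orders #Φ_p,
not the arithmetic Tamagawa numbers). = Pasten's folklore Conj. 1.14 in geometric form on the Frey
class, many-prime regime; for the Frey curve of an abc triple it reads ∏_{p | abc} v_p(abc) ≤ C_ε
rad(abc)^ε when ω(abc) ≥ 5, whence the milestone SubexpABCManyPrimes (landed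
subexpABCManyPrimes_of_manyPrimeFreyClass), with r4 the milestone AbcValuationProduct
(abcValuationProduct_of_manyPrimeFreyClass), and AssemblyFrey (abc_of_manyPrimeFreyClass) — all
three in Theorems/RibetTakahashiSplitManyPrimeValuationProductFreyClassSuffices.lean (p88416). WHY
THE RE-CUT (route-choice, M–O): on this class the Fermat input of the picked line
jl-zero-cycle-height (Pasten arXiv:1705.09251 L.6.12: for prime ℓ ≥ 11 some multi -/
@[route_item "route-ABC-RibetTakahashiSplit"]
def ManyPrimeValuationProductFrey : Prop :=
  ∀ ε : ℝ, 0 < ε → ∃ C : ℝ, ∀ (W : WeierstrassCurve ℚ) [W.IsElliptic], (∀ p : ℕ, p.Prime → p ≠ 2 → ¬ p ^ 2 ∣ W.conductorNorm ℤ) → (∃ (a b d : ℤ) (C' : WeierstrassCurve.VariableChange ℚ), IsCoprime a b ∧ a * b * (a + b) ≠ 0 ∧ d ∣ 2 ∧ C' • W = Literature.NumberTheory.EllipticCurves.freyCurve (d * a) (d * b)) → 4 ≤ ((W.conductorNorm ℤ).primeFactors.filter (fun p => p ≠ 2 ∧ ¬ p ^ 2 ∣ W.conductorNorm ℤ)).card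 → ((∏ p ∈ (W.conductorNorm ℤ).primeFactors with ¬ p ^ 2 ∣ W.conductorNorm ℤ, (W.minimalDiscriminantNorm ℤ).factorization p : ℕ) : ℝ) ≤ C * (W.conductorNorm ℤ : ℝ) ^ ε

/-- item stmt-ABC-15174 · aside · rank 2 · open · by planner
why it might fail: Truth: only ¬ABC refutes it. Mechanism: the KS/integral-structure defect of the JL transfer f_{D,M} may cost ≍ log p per prime p | DM even on Galois average (Liouville chain capped at θ = 1 by the height ½log(dDM²)), leaving ‖f_{D,M}‖² ≈ N^{1−c}; arithmetic half crux_D-equivalent under GLH.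
sources: PastenShimura2024, arXiv:1705.09251, RibetTakahashi1997, HoffsteinLockhart1994, Cesnavicius2018, arXiv:2207.12351
[crux] R2 = r2FS (rev 11 = route-choice 659892d6 re-cut of the Frey-class crux r2F
ManyPrimeValuationProductFrey, stmt-ABC-15149, to the SEMISTABLE Frey class, around the XL-apex fact
PastenShimura2024_cor_10_2; card ABC/ABC/jl-preserves-integral-size). For E/ℚ SEMISTABLE (p² ∤ N for
every prime p) and ℚ-isomorphic to a twisted Frey–Hellegouarch curve freyCurve (d a) (d b) (a, b
coprime, ab(a+b) ≠ 0, d ∣ 2) with ≥ 4 odd multiplicative primes: T(E) := ∏_{p ∥ N} ord_p(Δ_min(E)) ≤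
C_ε N^ε. = Pasten's folklore Conj. 1.14 in geometric form on the semistable Frey class (many-prime
regime) = the class of the Frey curve freyIntModel₂ of every abc triple with 16 ∣ abc and ω(abc) ≥ 5
(milestone SubexpABCManyPrimes on those triples). WHY THE RE-CUT: the package stub of the inherited
line (jlPackage_printedClass_of_facts,
Theorems/RibetTakahashiSplitManyPrimeValuationProductJLPackagePrintedClass.lean, hypothesis 8) needs
a UNIFORM bound on the Manin constant c_f of the X₀(N)-optimal curve of the class; for Frey curves
ADDITIVE at 2 (16 ∤ abc) that is Pasten Cor 10.2 with S = {2} (Thm 10.1's tower argument; in the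
tree only reduced to Thm 10.1 + Mazur, ShimuraCurveRibetTakahashiProofs.lean); on -/
@[route_item "route-ABC-RibetTakahashiSplit"]
def ManyPrimeValuationProductSemistableFrey : Prop :=
  ∀ ε : ℝ, 0 < ε → ∃ C : ℝ, ∀ (W : WeierstrassCurve ℚ) [W.IsElliptic], (∀ p : ℕ, p.Prime → ¬ p ^ 2 ∣ W.conductorNorm ℤ) → (∃ (a b d : ℤ) (C' : WeierstrassCurve.VariableChange ℚ), IsCoprime a b ∧ a * b * (a + b) ≠ 0 ∧ d ∣ 2 ∧ C' • W = Literature.NumberTheory.EllipticCurves.freyCurve (d * a) (d * b)) → 4 ≤ ((W.conductorNorm ℤ).primeFactors.filter (fun p => p ≠ 2 ∧ ¬ p ^ 2 ∣ W.conductorNorm ℤ)).card → ((∏ p ∈ (W.conductorNorm ℤ).primeFactors with ¬ p ^ 2 ∣ W.conductorNorm ℤ, (W.minimalDiscriminantNorm ℤ).factorization p : ℕ) : ℝ) ≤ C * (W.conductorNorm ℤ : ℝ) ^ ε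

/-- item stmt-ABC-3272 · support (kind.auto-crux: conjecture-grade) · rank 3 · open · by planner
why it might fail: Given r2∧r4 it IS generalized Szpiro (ABC-hard); indeed WeightedSzpiroBound ↔ ABC is kernel-checked (WeightedSzpiroBound.iff_abc: the weight T ≤ K_η|Δ|^η is absorbed). Mechanism: only arithmetic singles out the JL line in the Brandt module; a census with log ξ_f/log N > 2+δ refutes the exponent.
sources: BombieriGubler2006, RibetTakahashi1997, PollackWeston2011, AgasheRibetStein2011, ZagierCMB1985, Silverman1986
[crux] r3′ (arithmetic shadow of the relative degree bound; REPLACES RelativeDegreeBound of rev 0,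
whose typing needed ModularCurve and put modularity/newform facts into the import cone). For a
minimal ℤ-model W₀ of an elliptic curve E/ℚ semistable away from 2 (p² ∤ N for odd p; exactly the
hypotheses produced by Literature.NumberTheory.EllipticCurves.exists_minimal_frey_model),
max(|Δ(W₀)|, |c₄(W₀)|³) ≤ C_ε (N_E · T(E))^{6+ε}, T(E) := ∏_{p | N, p² ∤ N} ord_p(Δ_min) (geometric
component orders #Φ_p, not the arithmetic Tamagawa numbers). = generalized Szpiro
(BombieriGubler2006 Conj. 12.5.11, in tree as GeneralizedSzpiroConjectureBG, which implies it since
T ≥ 1) with the conductor replaced by the COMPONENT-WEIGHTED conductor N·T(E); together with r2 ∧ r4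
(T ≤ N^ε) it gives generalized Szpiro for Frey curves, hence ABC (Assembly). LINE OF ATTACK
(unchanged from rev 0; modular imports belong in the prover's Theorems file, not here): in print R3′
⟸ [some modular parametrisation of E has deg φ ≤ C_ε N^{2+ε}·T(E)] via Zagier's formula deg φ ·
covol(Λ_E) = 4π² c² (f,f) with c ∈ ℤ∖{0} (ZagierCMB1985; maninConstant_ne_zero in tree, so NO Manin
bound is needed in this direction), the GHL/Ho -/
@[route_item "route-ABC-RibetTakahashiSplit"]
def WeightedSzpiroBound : Prop :=
  ∀ ε : ℝ, 0 < ε → ∃ C : ℝ, ∀ W₀ : WeierstrassCurve ℤ, (W₀.baseChange ℚ).IsElliptic → (∀ v : IsDedekindDomain.HeightOneSpectrum ℤ, (W₀.baseChange ℚ).IsMinimalAt v) → (∀ p : ℕ, p.Prime → p ≠ 2 → ¬ p ^ 2 ∣ (W₀.baseChange ℚ).conductorNorm ℤ) → ((max |W₀.Δ| (|W₀.c₄| ^ 3) : ℤ) : ℝ) ≤ C * ((((W₀.baseChange ℚ).conductorNorm ℤ : ℕ) : ℝ) * ((∏ p ∈ ((W₀.baseChange ℚ).conductorNorm ℤ).primeFactors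 with ¬ p ^ 2 ∣ (W₀.baseChange ℚ).conductorNorm ℤ, ((W₀.baseChange ℚ).minimalDiscriminantNorm ℤ).factorization p : ℕ) : ℝ)) ^ (6 + ε)

/-! Retired items kept as plain definitions (history; not obligations of this route): landed proofs / closed glue still name them. -/

-- tombstone: stmt-ABC-15175 was DROPPED from this route but is still named by active items / landed proofs — kept as a plain def (no route_item tag), not an obligation of this route
/-- retired stmt-ABC-15175 (dropped, gen None) — proved by Summit.ABC.ABC.Theorems.ribetTakahashiSplit_assembly3_proof @ 04b4c2559f2f. -/
def Assembly3 : Prop :=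
  ManyPrimeValuationProductSemistableFrey → FewPrimeValuationProduct → WeightedSzpiroBound → ABC

/-- item stmt-ABC-15197 · aside · rank 4 · open · by planner
why it might fail: abc/Pillai strength in the BALANCED regime (p, q, r all large and comparable): p-adic linear forms in two logarithms give only ord_ℓ ≪ ℓ·polylog — the factor p of BakerMethodBounds (i) — so nothing beyond Stewart–Yu is known there; ε = 0 is false (Chen/Mersenne, Disproof).
sources: StewartYu2001, Pasten2024, PastenShimura2024, VonkanelMatschke2023, Literature.Barriers.ABC.BakerMethodBounds, arXiv:1705.09251
[crux] r4H — the HARD CORE of the few-prime regime (rev = route-choice M–O re-cut of the whole-class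
few-prime crux r4 FewPrimeValuationProduct, stmt-ABC-1563, now badged support). For every ε > 0
there is C such that every solution of p^x + q^y = 2^k r^z, p^x + 2^k r^z = q^y or q^y + 2^k r^z =
p^x in DISTINCT ODD primes p, q, r and exponents x, y, z, k ≥ 1 has x·y·z·k ≤ C·(2pqr)^ε. This is r4
VERBATIM on the Frey curves of the non-face abc triples with ω(abc) ≤ 4 (∏_{ℓ∣abc} v_ℓ(abc) = xyzk,
rad = 2pqr; T(E) ≍ xyz·max(1, 2k−8), N = 2^t pqr): the statement `stub_hardCore` of the lead's
reshaped skeleton Cruxes/FewPrimeValuationProduct/Lines/matveev_face_clearing.lean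
(prover-line-stmt-ABC-1563-1, PICKED.md / NOTES.md there), which the lead showed to be the NECESSARY
AND SUFFICIENT open content of r4 on the Frey class: SUFFICIENT — hard core ⟹ the valuation-product
bound on every non-face triple
(Theorems/RibetTakahashiSplitFewPrimeValuationProductStubNonfaceOfHardCore.lean,
stub_nonfaceOfHardCore, LANDED p98652, pure shape combinatorics from decisivePrimeBootstrap_shape
p85406), the power-of-two FACE being KNOWN (Matveev + Yu LFL in Pasten's form: stub_faceBound
p84330, log c ≤ κ (l -/
@[route_item "route-ABC-RibetTakahashiSplit"]
def FewPrimeHardCore : Prop :=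
  ∀ ε : ℝ, 0 < ε → ∃ C : ℝ, ∀ p q r x y z k : ℕ, p.Prime → q.Prime → r.Prime → Odd p → Odd q → Odd r → p ≠ q → p ≠ r → q ≠ r → 0 < x → 0 < y → 0 < z → 0 < k → (p ^ x + q ^ y = 2 ^ k * r ^ z ∨ p ^ x + 2 ^ k * r ^ z = q ^ y ∨ q ^ y + 2 ^ k * r ^ z = p ^ x) → ((x * y * z * k : ℕ) : ℝ) ≤ C * ((2 * p * q * r : ℕ) : ℝ) ^ ε

/-- item stmt-ABC-15193 · aside · rank 5 · open · by planner
why it might fail: KNOWN in print (Mazur1978 Thm 1 + Kenku1982; AEC IX.6 Ex 6.4): cannot fail. Risk formal, XL: Eisenstein-ideal proof of Mazur Thm 1 + Kenku levels (ccert 60/73). Absorbs all Mazur–Kenku inputs of both RT–Pasten packages: minimalDegree_le_163_mul, height comparison (now outright), raw list.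
sources: Mazur1978, Kenku1982, SilvermanAEC2009, PastenShimura2024, arXiv:1705.09251, Faltings1986FinitenessTranslation
[crux] MAZUR–KENKU RADIUS (route-choice cd68f10e, 2026-08-16: PROMOTION of the XL-apex Literature
fact Literature.NumberTheory.Automorphic.ShimuraParametrizationData.minimalDegree_le_163_mul —
hypothesis 5 of BOTH package theorems of this route, stub_twoPrimePackage_of_facts
(Theorems/RibetTakahashiSplitFewPrimeValuationProductStubTwoPrimePackage; crux r4 stmt-ABC-1563,
line switching-triangle, stub stub_twoPrimePackage) and jlPackage_printedClass_of_facts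
(Theorems/RibetTakahashiSplitManyPrimeValuationProductJLPackagePrintedClass; r2 family
stmt-ABC-1561/15149/15174) — in the RADIUS form every consumer actually uses). Statement: two
ℚ-isogenous elliptic curves over ℚ are joined by a ℚ-isogeny of degree ≤ 163 (Mazur 1978 Thm 1 +
Kenku 1982; Silverman AEC IX.6 Ex. 6.4; tree vocabulary WeierstrassCurve.IsIsogenous /
Isogeny.degree of Literature/NumberTheory/EllipticCurves/Isogeny). WHY THIS FORM. (i) The apex fact
is its PROVED corollary: glue minimalDegree_le_163_mul_of_radius : MazurKenkuRadius →
minimalDegree_le_163_mul (planner Sketch.lean, lean rc 0 — the tree's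
deg_le_163_mul_deg_of_isIsogenous uses Mazur–Kenku only through exists_isogeny_degree_le_163), and
so is the packages' -/
@[route_item "route-ABC-RibetTakahashiSplit"]
def MazurKenkuRadius : Prop :=
  ∀ (W W' : WeierstrassCurve ℚ) [W.IsElliptic] [W'.IsElliptic], W.IsIsogenous W' → ∃ φ : WeierstrassCurve.Isogeny W W', φ.degree ≤ 163

/-- item stmt-ABC-17906 · support · rank 5 · open · by planner
[crux] THE NON-FREY RESIDUAL of r4 (crux-strategist split, 2026-08-17; asked for by four seats: lead
gen 0 and gen 1 promote-stub stub_nonFreyResidual, lead c1, pitem release note): the few-prime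
valuation-product bound T(W) := ∏_{p ∥ N} ord_p Δ_min ≤ C_ε N^ε for W/ℚ semistable away from 2 with
≤ 3 odd multiplicative primes that admit NO numerical Frey shadow (no abc triple whose odd primes
are all multiplicative for W and whose doubled exponents dominate the component orders). Non-empty
and infinite: every curve of conductor 2^s·p with p not of Fermat/Mersenne type (11a, 19a, 37a, 52a,
176a, …), and every non-Frey curve of conductor 2^s·pq(r). KERNEL POSITION: FewPrimeValuationProduct
⟺ SubexpAbcFourPrimes ∧ NonFreyResidual UNCONDITIONALLY
(fewPrimeValuationProduct_iff_subexpFour_and_residual, p111514; this split's glue-by is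
fewPrimeValuationProduct_of_subexpFour_of_residual). MECHANISMS ON RECORD
(Cruxes/FewPrimeValuationProduct): crux|residual ⟺ PairwiseGcdBound ∧ DepthBound (hasse-pinning
certificates); pair half = Pasten Conj. 1.14 at the two-prime levels (pq, N/pq) =
stub_twoPrimeMeanSquareLowerBound of line switching-triangle (lead c2), shared with r2's lever;
depth half = -/
@[route_item "route-ABC-RibetTakahashiSplit"]
def NonFreyResidual : Prop :=
  ∀ ε : ℝ, 0 < ε → ∃ C : ℝ, ∀ (W : WeierstrassCurve ℚ) [W.IsElliptic], (∀ p : ℕ, p.Prime → p ≠ 2 → ¬ p ^ 2 ∣ W.conductorNorm ℤ) → ((W.conductorNorm ℤ).primeFactors.filter (fun p => p ≠ 2 ∧ ¬ p ^ 2 ∣ W.conductorNorm ℤ)).card ≤ 3 → (¬ ∃ a b c : ℕ, Literature.NumberTheory.DiophantineGeometry.IsABCTriple a b c ∧ (∀ p : ℕ, p.Prime → p ≠ 2 → p ∣ a * b * c → p ∣ W.conductorNorm ℤ) ∧ (∀ p ∈ (W.conductorNorm ℤ).primeFactors, ¬ p ^ 2 ∣ W.conductorNorm ℤ → (W.minimalDiscriminantNorm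 ℤ).factorization p ≤ 2 * (a * b * c).factorization p)) → ((∏ p ∈ (W.conductorNorm ℤ).primeFactors with ¬ p ^ 2 ∣ W.conductorNorm ℤ, (W.minimalDiscriminantNorm ℤ).factorization p : ℕ) : ℝ) ≤ C * (W.conductorNorm ℤ : ℝ) ^ ε

-- earlier SubexpOfValuationProduct (stmt-ABC-1572, replaced 2026-08-15T16:37:19Z -> stmt-ABC-11013): retired by None — (∀ ε : ℝ, 0 < ε → ∃ K : ℝ, ∀ a b c : ℕ, Literature.NumberTheory.DiophantineGeometry.IsABCTriple a b c → ((∏ p ∈ (a * b * c).primeFactors, (a * b * c).factorization p : ℕ) : ℝ) ≤ K * ((Literature.NumberTheory.DiophantineGeometry.rad a b c : ℕ) : ℝ) ^ ε) → ∀ ε : ℝ, 0 < ε → Literature.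
/-- item stmt-ABC-11013 · support · rank 9 · closed · proved by Summit.ABC.ABC.Theorems.subexpOfValuationProduct_proof (prover) · by planner
sources: StewartYu2001
[support] GLUE C, elementary, provable NOW (~80 lines): AbcValuationProduct → sub-exponential abc ∀ε
(log c ≤ κ_ε rad^ε). rev 2: conclusion UNFOLDED — it was `∀ ε > 0,
Literature.Barriers.ABC.BakerShapeBound ε 0`, i.e. ∃κ ∀ triples, log c ≤ κ·rad^ε·(log rad)^0,
identical up to pow_zero/mul_one; the abbreviation was the only reason this file imported the
barrier module Literature.Barriers.ABC.BakerMethodBounds (5 unproved benchmark facts in the cone).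
The conclusion is the shared milestone SubexpABC (target of route GiantExponentRegime, dropped from
THIS route's item list for the same reason). Proof: c = ∏_{p|c} p^{v_p(c)} ≤ rad(c)^{max_p v_p(c)},
so log c ≤ (∏_{p|abc} v_p(abc))·log rad(abc) ≤ K_{ε/2} rad^{ε/2} log rad ≤ κ rad^ε (log x ≤ (2/ε)
x^{ε/2}); edge (1,1,2): rad = 2. A candidate GlueCProof.lean is attached (twice) against the old
wording — adapt its last line. Sources: StewartYu2001 (shape), PastenShimura2024 Thm 1.10/1.11. -/
@[route_item "route-ABC-RibetTakahashiSplit"]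
def SubexpOfValuationProduct : Prop :=
  (∀ ε : ℝ, 0 < ε → ∃ K : ℝ, ∀ a b c : ℕ, Literature.NumberTheory.DiophantineGeometry.IsABCTriple a b c → ((∏ p ∈ (a * b * c).primeFactors, (a * b * c).factorization p : ℕ) : ℝ) ≤ K * ((Literature.NumberTheory.DiophantineGeometry.rad a b c : ℕ) : ℝ) ^ ε) → ∀ ε : ℝ, 0 < ε → ∃ κ : ℝ, ∀ a b c : ℕ, Literature.NumberTheory.DiophantineGeometry.IsABCTriple a b c → Real.log c ≤ κ * ((Literature.NumberTheory.DiophantineGeometry.rad a b c : ℕ) : ℝ) ^ ε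

-- `SubexpOfValuationProduct` holds: proved by `Summit.ABC.ABC.Theorems.subexpOfValuationProduct_proof` (its module imports this route file, so no `_holds` link can be stated here).

/-- item stmt-ABC-15151 · support · rank 9 · closed · proved by Summit.ABC.ABC.Theorems.manyPrimeFreyOfManyPrime_proof @ 5c96a6787347 (prover) · by planner
[support] GLUE r2 → r2F, provable NOW (2 lines: drop the Frey hypothesis; planner Sketch.lean
`manyPrimeFreyOfManyPrime_holds`). Records in the file that the whole-class r2
ManyPrimeValuationProduct (stmt-ABC-1561, re-badged support in rev 6) is the STRONGER statement: r2
= r2F + the semistable non-Frey class (its Fermat input is Mestre–Oesterlé Thm 1 / Pasten L.6.11 =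
Mazur + Ribet + Wiles, the XL named fact mestreOesterle1989_thm_1) + the residual class additive at
2 with no Frey model (Fermat input OPEN, Frey–Mazur flavour: skeleton stub_fermatInputResidual);
neither extra class is consumed by any item of this route (FreyClassSuffices, p88416), which is why
the route was re-cut rather than M–O promoted to a crux. [deps: ManyPrimeValuationProduct,
ManyPrimeValuationProductFrey] [difficulty: provable-now] -/
@[route_item "route-ABC-RibetTakahashiSplit"]
def ManyPrimeFreyOfManyPrime : Prop :=
  ManyPrimeValuationProduct → ManyPrimeValuationProductFrey

-- `ManyPrimeFreyOfManyPrime` holds: proved by `Summit.ABC.ABC.Theorems.manyPrimeFreyOfManyPrime_proof` @ 5c96a6787347 (its module imports this route file, so no `_holds` link can be stated here).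

/-- item stmt-ABC-1570 · support · rank 9 · closed · proved by Summit.ABC.ABC.Theorems.subexpManyPrimesOfValuationProduct_proof (prover) · by planner
sources: PastenShimura2024, BombieriGubler2006
[support] GLUE A, provable NOW (~250 lines): r2 -> SubexpABCManyPrimes. For a triple with omega(abc)
>= 5 take the Frey model (exists_arrangement + freyIntModel₂ if 16 | abc, else freyIntModel): it is
semistable away from 2, the odd multiplicative primes are exactly the odd p | abc (>= 4 of them;
multiplicative reduction at odd p from SzpiroLocalDataProofs, cond | rad resp. 2^10 rad),
ord_p(Delta_min) = 2 v_p(abc) for odd p (Delta_min = 2^{-8}(abc)^2 resp. 16 (abc)^2;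
minimalDiscriminantNorm of a globally minimal model = |Delta|), and v_2(abc) <= 4 max(1,
ord_2(Delta_min)) resp. <= 3. Hence prod_{p|abc} v_p(abc) <= 8 T(E) <= 8 C N^{eps/2} <= 8 C 2^{5
eps} rad^{eps/2}; and log c <= (max_p v_p(c)) log rad(c) <= (prod_p v_p(abc)) log rad <= kappa
rad^eps (log x <= (2/eps) x^{eps/2}). -/
@[route_item "route-ABC-RibetTakahashiSplit"]
def SubexpManyPrimesOfValuationProduct : Prop :=
  (∀ ε : ℝ, 0 < ε → ∃ C : ℝ, ∀ (W : WeierstrassCurve ℚ) [W.IsElliptic], (∀ p : ℕ, p.Prime → p ≠ 2 → ¬ p ^ 2 ∣ W.conductorNorm ℤ) → 4 ≤ ((W.conductorNorm ℤ).primeFactors.filter (fun p => p ≠ 2 ∧ ¬ p ^ 2 ∣ W.conductorNorm ℤ)).card → ((∏ p ∈ (W.conductorNorm ℤ).primeFactors with ¬ p ^ 2 ∣ W.conductorNorm ℤ, (W.minimalDiscriminantNorm ℤ).factorization p : ℕ) : ℝ) ≤ C * (W.conductorNorm ℤ : ℝ) ^ ε) → ∀ ε : ℝ, 0 < ε → ∃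 κ : ℝ, ∀ a b c : ℕ, Literature.NumberTheory.DiophantineGeometry.IsABCTriple a b c → 5 ≤ (a * b * c).primeFactors.card → Real.log c ≤ κ * ((Literature.NumberTheory.DiophantineGeometry.rad a b c : ℕ) : ℝ) ^ ε

-- `SubexpManyPrimesOfValuationProduct` holds: proved by `Summit.ABC.ABC.Theorems.subexpManyPrimesOfValuationProduct_proof` (its module imports this route file, so no `_holds` link can be stated here).

/-- item stmt-ABC-1571 · support · rank 9 · closed · proved by Summit.ABC.ABC.Theorems.valuationProductOfCurves_proof (prover) · by planner
sources: BombieriGubler2006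
[support] GLUE B, provable NOW (~250 lines, shares its lemmas with glue A via --supports): r2 -> r4
-> AbcValuationProduct. Same Frey translation without the omega restriction: use r2 when >= 4 odd
primes divide abc, r4 otherwise; prod_{p|abc} v_p(abc) <= 8 T(E) <= 8 C N^eps <= K rad^eps. -/
@[route_item "route-ABC-RibetTakahashiSplit"]
def ValuationProductOfCurves : Prop :=
  (∀ ε : ℝ, 0 < ε → ∃ C : ℝ, ∀ (W : WeierstrassCurve ℚ) [W.IsElliptic], (∀ p : ℕ, p.Prime → p ≠ 2 → ¬ p ^ 2 ∣ W.conductorNorm ℤ) → 4 ≤ ((W.conductorNorm ℤ).primeFactors.filter (fun p => p ≠ 2 ∧ ¬ p ^ 2 ∣ W.conductorNorm ℤ)).card → ((∏ p ∈ (W.conductorNorm ℤ).primeFactors with ¬ p ^ 2 ∣ W.conductorNorm ℤ, (W.minimalDiscriminantNorm ℤ).factorization p : ℕ) : ℝ) ≤ C * (W.conductorNorm ℤ : ℝ) ^ ε) → (∀ ε : ℝ, 0 < ε → ∃ C : ℝ, ∀ (W : WeierstrassCurve ℚ) [W.IsElliptic], (∀ p : ℕ, p.Prime → p ≠ 2 →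 ¬ p ^ 2 ∣ W.conductorNorm ℤ) → ((W.conductorNorm ℤ).primeFactors.filter (fun p => p ≠ 2 ∧ ¬ p ^ 2 ∣ W.conductorNorm ℤ)).card ≤ 3 → ((∏ p ∈ (W.conductorNorm ℤ).primeFactors with ¬ p ^ 2 ∣ W.conductorNorm ℤ, (W.minimalDiscriminantNorm ℤ).factorization p : ℕ) : ℝ) ≤ C * (W.conductorNorm ℤ : ℝ) ^ ε) → ∀ ε : ℝ, 0 < ε → ∃ K : ℝ, ∀ a b c : ℕ, Literature.NumberTheory.DiophantineGeometry.IsABCTriple a b c → ((∏ p ∈ (a * b * c).primeFactors, (a * b * c).factorization p : ℕ) : ℝ) ≤ K * ((Literature.NumberTheory.DiophantineGeometry.rad a b c : ℕ) : ℝ) ^ ε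

-- `ValuationProductOfCurves` holds: proved by `Summit.ABC.ABC.Theorems.valuationProductOfCurves_proof` (its module imports this route file, so no `_holds` link can be stated here).

/-- item stmt-ABC-18066 · support · rank 9 · open · by planner
[support] GLUE for the P2 re-point of `closes` (route-choice da741772 = the route's TENURE TODO;
PROVABLE NOW): the live semistable-Frey many-prime crux R2SF together with the thin-class crux r3″
gives the derived node r3′ = WeightedSzpiroBound (⟺ ABC in the tree) and hence the whole-class
valuation-product statements r2 ∧ r4. Content = thin Frey transfer + ω-lift: for a triple with 16 ∣
abc take the semistable global minimal Frey model W₀ = freyIntModel₂ A B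
(ThinFreyTransfer.exists_semistable_minimal_frey_model, file
Theorems/RibetTakahashiSplitThinFreyTransfer.lean); θ from r3″, R2SF(θ) certifies θ-thinness when
abc has ≥ 4 odd primes, r3″ at (δ, K) with δ = min(ε,1)/2 and R2SF(δ/20) absorbs T: c⁶ ≤ 8|c₄|³ ≤
M·rad^{6(1+ε)} — abc(≤) on {16 ∣ abc, ≥ 4 odd primes} (= the dropped item stmt-ABC-17852, proved
2026-08-17 against the same-ε r3″; two-level re-run); then the 16-reduction threaded with the
odd-prime count (re-run of DiophantineGeometry.abcLe_of_abcLe_sixteen_dvd: the device (u⁸, v⁸−u⁸,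
v⁸) keeps every odd prime of abc) and the LANDED ω-lift OmegaLift.abc_of_manyOddPrimes 4 give ABC,
whence WeightedSzpiroBound (WeightedSzpiroBound.iff_abc.mpr, landed) and r2 ∧ r4 (manyPrime -/
@[route_item "route-ABC-RibetTakahashiSplit"]
def ThinOmegaLift : Prop :=
  ManyPrimeValuationProductSemistableFrey → ThinWeightedSzpiro → WeightedSzpiroBound ∧ ManyPrimeValuationProduct ∧ FewPrimeValuationProduct

/-- item stmt-ABC-2637 · support · rank 9 · closed · proved by Summit.ABC.ABC.Theorems.discrepancyPotentialBound_proof (prover) · by planner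
[support] SERRE'S LOG-GAS LEMMA (pure real analysis, provable NOW; the potential-theoretic heart of
idea card ABC/ABC/serre-potential-log-free-szpiro, its item S1; planner sketch SketchRTS.lean rc 0).
Kesten-McKay / Serre law of T_l-eigenvalues on [-2 sqrt l, 2 sqrt l] (unnormalised variable): dmu_l
= (l+1) sqrt(4l - t^2) dt / (2 pi ((l+1)^2 - t^2)) (SerreHeckeEquidistribution1997 Thm 1, pushed
forward by t = sqrt(l) x; total mass 1, re-checked numerically), logarithmic potential U_l(a) := Int
log|a - t| dmu_l(t). STATEMENT: for l >= 2 and eps > 0 there is delta > 0 such that for any points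
x_1..x_n in [-2 sqrt l, 2 sqrt l] whose Kolmogorov discrepancy to mu_l is <= delta (every interval
[alpha, beta]) and every |a| <= 2 sqrt l: (1/n) Sum_{i : x_i != a} log|a - x_i| <= U_l(a) + eps.
PROOF: log|a - t| <= phi_K(t) := max(log|a-t|, -K); Int phi_K dmu_l decreases to U_l(a) as K ->
infinity, uniformly in a on the compact range (Dini; U_l continuous since mu_l has bounded density);
Koksma's inequality for phi_K (variation <= 2K + O(log l)) bounds |(1/n) Sum_i phi_K(x_i) - Int
phi_K dmu_l| <= Var * delta; the excluded points x_i = a number <= delta n (discrepancy of the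
degenerate interva -/
@[route_item "route-ABC-RibetTakahashiSplit"]
def DiscrepancyPotentialBound : Prop :=
  ∀ (ℓ : ℕ), 2 ≤ ℓ → ∀ ε : ℝ, 0 < ε → ∃ δ : ℝ, 0 < δ ∧ ∀ (n : ℕ) (x : Fin n → ℝ), 0 < n → (∀ i, |x i| ≤ 2 * Real.sqrt ℓ) → (∀ α β : ℝ, α ≤ β → |((Finset.univ.filter (fun i => x i ∈ Set.Icc α β)).card : ℝ) / n - ∫ t in α..β, ((ℓ : ℝ) + 1) * Real.sqrt (4 * ℓ - t ^ 2) / (2 * Real.pi * (((ℓ : ℝ) + 1) ^ 2 - t ^ 2))| ≤ δ) → ∀ a : ℝ, |a| ≤ 2 * Real.sqrt ℓ → (∑ i, if x i = a then (0 : ℝ) else Real.log |a - x i|) / n ≤ (∫ t in (-(2 * Real.sqrt ℓ))..(2 * Real.sqrt ℓ), Real.log |a - t| * (((ℓ : ℝ) + 1) * Real.sqrt (4 * ℓ - t ^ 2) / (2 * Real.pi * (((ℓ : ℝ) + 1) ^ 2 - t ^ 2)))) + ε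

-- `DiscrepancyPotentialBound` holds: proved by `Summit.ABC.ABC.Theorems.discrepancyPotentialBound_proof` (its module imports this route file, so no `_holds` link can be stated here).

-- earlier Assembly (stmt-ABC-1564, replaced 2026-08-15T16:37:19Z -> stmt-ABC-11012): retired by None — (∀ ε : ℝ, 0 < ε → ∃ C : ℝ, ∀ (W : WeierstrassCurve ℚ) [W.IsElliptic], (∀ p : ℕ, p.Prime → p ≠ 2 → ¬ p ^ 2 ∣ W.conductorNorm ℤ) → 4 ≤ ((W.conductorNorm ℤ).primeFactors.filter (fun p => p ≠ 2 ∧ ¬ p ^ 2 ∣ W.conductorNorm ℤ)).card → ((∏ p ∈ (W.conductorNorm ℤ).primeFactors with ¬ p ^ 2 ∣ W.conductorNor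
/-- item stmt-ABC-11012 · assembly · rank 1 · closed · proved by Summit.ABC.ABC.Theorems.WeightedSzpiroBound.assembly_of_crux (prover) · by planner
sources: ZagierCMB1985, Silverman1986, HoffsteinLockhart1994, BombieriGubler2006
[assembly] rev 2: r2 → r4 → r3′ → ABC BY DECL NAME (ManyPrimeValuationProduct →
FewPrimeValuationProduct → WeightedSzpiroBound → ABC); replaces the rev-0 chain r2 → r4 →
RelativeDegreeBound → PeterssonLowerBound → CovolumeSzpiroBound → (∀ D, zagier_degree_formula) →
nonempty_modularParametrizationData → ABC, whose inlined hypotheses were the gate's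
glue.extra-hypothesis and whose modular objects put 26 unproved named facts into the cone. PROVABLE
NOW; candidate proof attached as item evidence (planner AssemblyProof.lean, lean check rc 0, axioms
propext/Classical.choice/Quot.sound, ~110 lines; a prover re-targets it at this decl importing the
route module + Literature.NumberTheory.EllipticCurves.SzpiroFreyProofs): given ε put δ = min(ε,1)/2,
C₀ = max(C₂,C₄,1) from r2/r4 at δ, C₁ = max(C₃,0) from r3′ at δ, M = 8·C₁·C₀^{6+δ}·(2^10)^{6+6ε}, C
= M^{1/6}+1 > 0. For a triple: exists_minimal_frey_model gives W₀/ℤ elliptic, minimal at every v, N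
∣ 2^10·rad, c² ≤ 2|c₄|; p odd with p² ∣ N ⇒ p² ∣ rad (coprime to 2^10), impossible as rad =
radical(abc) is squarefree (UniqueFactorizationMonoid.squarefree_radical) — so W₀ is semistable away
from 2; by le_or_gt on the number of odd multiplicative -/
@[route_item "route-ABC-RibetTakahashiSplit"]
def Assembly : Prop :=
  ManyPrimeValuationProduct → FewPrimeValuationProduct → WeightedSzpiroBound → ABC

-- `Assembly` holds: proved by `Summit.ABC.ABC.Theorems.WeightedSzpiroBound.assembly_of_crux` (its module imports this route file, so no `_holds` link can be stated here).

-- records of items no longer active in this route (dropped / restated):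
-- earlier IsogenyDegreeBoundOfRadius (stmt-ABC-14984, dropped 2026-08-16T14:16:23Z): moot by None — MazurKenkuRadius → IsogenyDegreeBound
-- earlier Assembly2 (stmt-ABC-15150, dropped 2026-08-16T14:15:59Z): proved by Summit.ABC.ABC.Theorems.ribetTakahashiSplit_assembly2_proof @ 01cae614252d — ManyPrimeValuationProductFrey → FewPrimeValuationProduct → WeightedSzpiroBound → ABC
-- earlier Assembly3 (stmt-ABC-15175, dropped 2026-08-16T14:15:59Z): proved by Summit.ABC.ABC.Theorems.ribetTakahashiSplit_assembly3_proof @ 04b4c2559f2f — ManyPrimeValuationProductSemistableFrey → FewPrimeValuationProduct → WeightedSzpiroBound → ABC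
-- earlier Assembly4 (stmt-ABC-15198, dropped 2026-08-16T14:15:59Z): moot by None — ManyPrimeValuationProductSemistableFrey → FewPrimeHardCore → WeightedSzpiroBound → ABC
-- earlier Assembly2 (stmt-ABC-15513, dropped 2026-08-17T04:22:43Z): proved by Summit.ABC.ABC.Theorems.ribetTakahashiSplit_assembly2_proof @ 57217864106c — ManyPrimeValuationProductSemistableFrey → WeightedSzpiroBound → _root_.ABC
-- earlier AbcValuationProduct (stmt-ABC-1567, dropped 2026-08-16T14:16:23Z): moot by None — ∀ ε : ℝ, 0 < ε → ∃ K : ℝ, ∀ a b c : ℕ, Literature.NumberTheory.DiophantineGeometry.IsABCTriple a b c → ((∏ p ∈ (a * b * c).primeFactors, (a * b * c).factorization p : ℕ) : ℝ) ≤ K * ((Literature.NumberTheory.DiophantineGeometry.rad a b c : ℕ) : ℝ) ^ ε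
-- earlier SubexpABCManyPrimes (stmt-ABC-1568, dropped 2026-08-16T14:16:23Z): moot by None — ∀ ε : ℝ, 0 < ε → ∃ κ : ℝ, ∀ a b c : ℕ, Literature.NumberTheory.DiophantineGeometry.IsABCTriple a b c → 5 ≤ (a * b * c).primeFactors.card → Real.log c ≤ κ * ((Literature.NumberTheory.DiophantineGeometry.rad a b c : ℕ) : ℝ) ^ ε
-- earlier ThinFreyTransfer (stmt-ABC-17852, dropped 2026-08-17T05:17:30Z): moot by None — ManyPrimeValuationProductSemistableFrey → ThinWeightedSzpiro → ∀ ε : ℝ, 0 < ε → ∃ C : ℝ, ∀ a b c : ℕ, Literature.NumberTheory.DiophantineGeometry.IsABCTriple a b c → 16 ∣ a * b * c → 4 ≤ ((a * b * c).primeFactors.filter (fun p => p ≠ 2)).card → (c : ℝ) ≤ C * ((Literature.NumberTheory.DiophantineGeometry.rad a b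
-- earlier Assembly2 (stmt-ABC-18000, dropped 2026-08-17T06:27:44Z): moot by None — ManyPrimeValuationProductSemistableFrey → ThinWeightedSzpiro → _root_.ABC

/-! D-0027 §2.1 — DECIDING THEOREM (planner-authored via `route open/edit --closes-file`; by planner-rrefute-ABC-RibetTakahashiSplit-stmt-A-9a5700cc-0 2026-08-17T05:17:30Z):
its hypotheses are this route's items and its conclusion the sub-problem Statement (glue_lint), and it elaborates with this file. -/

@[closes "route-ABC-RibetTakahashiSplit"] theorem closes (h₂ : ManyPrimeValuationProduct) (h₄ : FewPrimeValuationProduct)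
    (hT : ThinWeightedSzpiro) (hA : Assembly) : _root_.ABC := by
  -- r3′ = WeightedSzpiroBound is DERIVED here (no longer a leaf). Repair 2026-08-17 (stmt-ABC-17736
  -- refuted-misstated, same-ε bootstrap): the thin class now has a FROZEN exponent θ supplied ONCE by
  -- the crux r3″ (∃ θ > 0, …); the valuation-product half r2 ∧ r4 is instantiated at that single level θ
  -- to certify that every curve semistable away from 2 is θ-thin with constant K = max K₂ K₄, and r3″
  -- then gives the weighted Szpiro bound for every ε; the PROVED item `Assembly` (r2 → r4 → r3′ → ABC)
  -- decides the summit.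
  refine hA h₂ h₄ ?_
  obtain ⟨θ, hθ, hθT⟩ := hT
  obtain ⟨K₂, hK₂⟩ := h₂ θ hθ
  obtain ⟨K₄, hK₄⟩ := h₄ θ hθ
  intro ε hε
  obtain ⟨C, hC⟩ := hθT ε hε (max K₂ K₄)
  refine ⟨C, fun W₀ hE hmin hss => hC W₀ hE hmin hss ?_⟩
  haveI := hE
  have hN : (0 : ℝ) ≤ (((W₀.baseChange ℚ).conductorNorm ℤ : ℕ) : ℝ) ^ θ := by positivity
  rcases le_or_gt 4 (((W₀.baseChange ℚ).conductorNorm ℤ).primeFactors.filter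
      (fun p => p ≠ 2 ∧ ¬ p ^ 2 ∣ (W₀.baseChange ℚ).conductorNorm ℤ)).card with h4 | h3
  · exact (hK₂ (W₀.baseChange ℚ) hss h4).trans (mul_le_mul_of_nonneg_right (le_max_left _ _) hN)
  · exact (hK₄ (W₀.baseChange ℚ) hss (by omega)).trans
      (mul_le_mul_of_nonneg_right (le_max_right _ _) hN)

end Summit.ABC.ABC.Theses.RibetTakahashiSplit
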